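import Literature.Probability.FitznerVanDerHofstad2017.NoGoFrame

/-!
# The eigen-tail leaf (E1) of the d = 10 no-go frame: termwise-monotone series, Neumann domains, and the Collatz–Wielandt divergence certificate

The `N ≥ 4` remainder tails of the NoBLE percolation bounds — `Percolation.nb` l.640–653 (the `Eigensystem` of the
stage-1 matrices `B_s`, `B̄_s`) and l.841–844, 860–869 (the `EvenTail` / `OddTail` cells of `Bound[Xi,…]`,
`Bound[XiIota,…]`) — implement the `N`-sums of [FvdH17, extended version App. C] as closed forms `e^3/(1-e^2)`-type in
the eigenvalues.  Expanded, each tail is a series `Σ_{a,b ≥ 0} φ_{ab} · uᵀ B^{α+2a} M B̄^{β+2b} w` with `φ_{ab} ≥ 0` and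
entrywise non-negative ingredients `u, B, M, B̄, w` that are non-decreasing functions of the bootstrap state `y`; it
converges exactly on the region where the Neumann series of `B²` and `B̄²` converge (`ρ(B), ρ(B̄) < 1`; [DingZhou2009,
§1.2 Thm. 1.2]).  In the frame `NoGoFrame.Frame` this region is the abstract validity predicate `Frame.U` and the two
facts used about it are the fields `Frame.Hyp.U_down` (downward closed) and the tails part of `Frame.Hyp.mono`.

This module proves the GENERIC facts behind those two fields and behind the "`ρ ≥ 1`" escape certificate:

* `termwise_summable_mono` — a series whose terms are non-negative and non-decreasing functions of `y` on the cone above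
  `y₀` has a downward-closed domain of convergence and a non-decreasing sum (E1 (iii)+(iv) in abstract form);
  `Frame.U_down_of_termwise` restates it as a discharger of `Frame.Hyp.U_down`.
* `pow_apply_nonneg`, `pow_apply_mono`, `mul_apply_nonneg`, `mul_apply_mono`, `mulVec_nonneg`, `mulVec_mono`,
  `dotProduct_mono'`, `tailTerm_nonneg`, `tailTerm_mono` — entrywise order facts for products and powers of
  non-negative matrices, so that each term `φ • u ⬝ᵥ ((B^p * M * B̄^q) *ᵥ w)` satisfies the hypotheses of the first item
  as soon as its ingredients do ([DingZhou2009, §1.2 Cor. 1.1] is the spectral-radius form of `pow_apply_mono`).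
* `NeumannDom`, `neumannDom_anti` — the entrywise Neumann domain `{B : Σ_k (B^k)_{ij} summable ∀ i j}` is downward
  closed on non-negative matrices.
* `le_pow_mulVec`, `not_neumannDom_of_subharmonic` (+ the row-sum / column-sum special cases
  `not_neumannDom_of_rowSum`, `not_neumannDom_of_colSum`, `neumannDom_transpose_iff`) — COLLATZ–WIELANDT
  DIVERGENCE CERTIFICATE: `0 ≤ B`, `v ≤ B v`
  entrywise and `v_{i₀} > 0` imply that the Neumann series of `B` diverges (row `i₀`), i.e. the state is outside the
  validity region.  This is the admissible, exactly checkable form of a "`ρ(B) ≥ 1`" escape: a float eigenvalue is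
  not a certificate, an interval-verified vector inequality `B v ≥ v` is.

Nothing here is specific to `d = 10`; no numeral of the notebooks occurs.
-/

namespace Literature.Probability.FitznerVanDerHofstad2017.EigenTails

open Matrix Finset

/-! ## Termwise-monotone series (E1 (iii)+(iv), abstract form) -/

section Series

variable {S : Type*} [Preorder S]

/-- A series `Σ_k f k y` whose terms are, on the cone above `y₀`, non-negative and non-decreasing in `y`: if it
converges at `y` then it converges at every `x ∈ [y₀, y]` and its sum there is at most the sum at `y`.  (Comparison
test; this is Lemma E1 (iii)+(iv) of the d = 10 census with the matrix structure abstracted away.) [folklore] -/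
theorem termwise_summable_mono (f : ℕ → S → ℝ) (y₀ : S)
    (h0 : ∀ k ⦃y⦄, y₀ ≤ y → 0 ≤ f k y) (hmono : ∀ k ⦃x y⦄, y₀ ≤ x → x ≤ y → f k x ≤ f k y)
    ⦃x y : S⦄ (hx : y₀ ≤ x) (hxy : x ≤ y) (hs : Summable fun k => f k y) :
    Summable (fun k => f k x) ∧ ∑' k, f k x ≤ ∑' k, f k y := by
  have hle : ∀ k, f k x ≤ f k y := fun k => hmono k hx hxy
  have hsx : Summable (fun k => f k x) := Summable.of_nonneg_of_le (fun k => h0 k hx) hle hs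
  exact ⟨hsx, hsx.tsum_le_tsum hle hs⟩

/-- Family version: a validity predicate defined as "every series of the family converges" is downward closed on
the cone above `y₀` when all terms are non-negative and non-decreasing there. [folklore] -/
theorem down_closed_of_termwise {ι : Type*} (f : ι → ℕ → S → ℝ) (y₀ : S)
    (h0 : ∀ i k ⦃y⦄, y₀ ≤ y → 0 ≤ f i k y) (hmono : ∀ i k ⦃x y⦄, y₀ ≤ x → x ≤ y → f i k x ≤ f i k y)
    ⦃x y : S⦄ (hx : y₀ ≤ x) (hxy : x ≤ y) (hs : ∀ i, Summable fun k => f i k y) :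
    ∀ i, Summable fun k => f i k x :=
  fun i => (termwise_summable_mono (f i) y₀ (h0 i) (hmono i) hx hxy (hs i)).1

end Series

/-! ## Entrywise order facts for non-negative matrices -/

section Matrices

variable {n : Type*}

/-- Entries of powers of an entrywise non-negative matrix are non-negative. [folklore] -/
theorem pow_apply_nonneg [Fintype n] [DecidableEq n] {A : Matrix n n ℝ} (hA : ∀ i j, 0 ≤ A i j) :
    ∀ (k : ℕ) (i j : n), 0 ≤ (A ^ k) i j := by
  intro k
  induction k with
  | zero =>
    intro i j
    rw [pow_zero, Matrix.one_apply]
    split_ifs <;> norm_num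
  | succ k ih =>
    intro i j
    rw [pow_succ, Matrix.mul_apply]
    exact Finset.sum_nonneg fun l _ => mul_nonneg (ih i l) (hA l j)

/-- Entrywise `0 ≤ A ≤ B` implies entrywise `A^k ≤ B^k` (the entrywise form of the monotonicity of the spectral
radius on non-negative matrices, [DingZhou2009, §1.2 Cor. 1.1]).
[cite: DingZhou2009, §1.2 Corollary 1.1 (PDF p. 14)] -/
theorem pow_apply_mono [Fintype n] [DecidableEq n] {A B : Matrix n n ℝ} (hA : ∀ i j, 0 ≤ A i j) (hAB : ∀ i j, A i j ≤ B i j) :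
    ∀ (k : ℕ) (i j : n), (A ^ k) i j ≤ (B ^ k) i j := by
  have hB : ∀ i j, 0 ≤ B i j := fun i j => (hA i j).trans (hAB i j)
  intro k
  induction k with
  | zero => intro i j; simp
  | succ k ih =>
    intro i j
    rw [pow_succ, pow_succ, Matrix.mul_apply, Matrix.mul_apply]
    exact Finset.sum_le_sum fun l _ =>
      mul_le_mul (ih i l) (hAB l j) (hA l j) (pow_apply_nonneg hB k i l)

/-- Products of entrywise non-negative matrices are entrywise non-negative. [folklore] -/
theorem mul_apply_nonneg {m p : Type*} [Fintype m] {A : Matrix n m ℝ} {C : Matrix m p ℝ}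
    (hA : ∀ i j, 0 ≤ A i j) (hC : ∀ i j, 0 ≤ C i j) (i : n) (j : p) : 0 ≤ (A * C) i j := by
  rw [Matrix.mul_apply]
  exact Finset.sum_nonneg fun l _ => mul_nonneg (hA i l) (hC l j)

/-- Entrywise monotonicity of the product of non-negative matrices. [folklore] -/
theorem mul_apply_mono {m p : Type*} [Fintype m] {A A' : Matrix n m ℝ} {C C' : Matrix m p ℝ}
    (hA : ∀ i j, 0 ≤ A i j) (hC : ∀ i j, 0 ≤ C i j)
    (hAA : ∀ i j, A i j ≤ A' i j) (hCC : ∀ i j, C i j ≤ C' i j) (i : n) (j : p) :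
    (A * C) i j ≤ (A' * C') i j := by
  rw [Matrix.mul_apply, Matrix.mul_apply]
  exact Finset.sum_le_sum fun l _ =>
    mul_le_mul (hAA i l) (hCC l j) (hC l j) ((hA i l).trans (hAA i l))

/-- `A v ≥ 0` entrywise for `A, v ≥ 0` entrywise. [folklore] -/
theorem mulVec_nonneg {m : Type*} [Fintype m] {A : Matrix n m ℝ} {v : m → ℝ}
    (hA : ∀ i j, 0 ≤ A i j) (hv : ∀ j, 0 ≤ v j) (i : n) : 0 ≤ (A *ᵥ v) i := by
  simp only [Matrix.mulVec, dotProduct]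
  exact Finset.sum_nonneg fun l _ => mul_nonneg (hA i l) (hv l)

/-- Entrywise monotonicity of `A v` in `(A, v)` for non-negative data. [folklore] -/
theorem mulVec_mono {m : Type*} [Fintype m] {A A' : Matrix n m ℝ} {v v' : m → ℝ}
    (hA : ∀ i j, 0 ≤ A i j) (hv : ∀ j, 0 ≤ v j) (hAA : ∀ i j, A i j ≤ A' i j) (hvv : ∀ j, v j ≤ v' j)
    (i : n) : (A *ᵥ v) i ≤ (A' *ᵥ v') i := by
  simp only [Matrix.mulVec, dotProduct]
  exact Finset.sum_le_sum fun l _ => mul_le_mul (hAA i l) (hvv l) (hv l) ((hA i l).trans (hAA i l))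

/-- Monotonicity of the dot product `u ⬝ᵥ z` in `(u, z)` for non-negative data. [folklore] -/
theorem dotProduct_mono' [Fintype n] {u u' z z' : n → ℝ} (hu : ∀ i, 0 ≤ u i) (hz : ∀ i, 0 ≤ z i)
    (huu : ∀ i, u i ≤ u' i) (hzz : ∀ i, z i ≤ z' i) : u ⬝ᵥ z ≤ u' ⬝ᵥ z' := by
  simp only [dotProduct]
  exact Finset.sum_le_sum fun l _ => mul_le_mul (huu l) (hzz l) (hz l) ((hu l).trans (huu l))

/-- One term of an eigen tail: `φ · uᵀ (B^p M B̄^q) w` (`Percolation.nb` l.841–869 expanded termwise; census E1 (i)).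
[cite: FitznerVanDerHofstad2017, notebook Percolation.nb l.640–653, 841–844, 860–869] -/
def tailTerm [Fintype n] [DecidableEq n] (φ : ℝ) (u : n → ℝ) (B : Matrix n n ℝ) (p : ℕ) (M : Matrix n n ℝ) (Bb : Matrix n n ℝ) (q : ℕ)
    (w : n → ℝ) : ℝ :=
  φ * (u ⬝ᵥ ((B ^ p * M * Bb ^ q) *ᵥ w))

/-- A tail term with non-negative ingredients is non-negative. [folklore] -/
theorem tailTerm_nonneg [Fintype n] [DecidableEq n] {φ : ℝ} {u w : n → ℝ} {B M Bb : Matrix n n ℝ} (hφ : 0 ≤ φ) (hu : ∀ i, 0 ≤ u i)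
    (hB : ∀ i j, 0 ≤ B i j) (hM : ∀ i j, 0 ≤ M i j) (hBb : ∀ i j, 0 ≤ Bb i j) (hw : ∀ i, 0 ≤ w i) (p q : ℕ) :
    0 ≤ tailTerm φ u B p M Bb q w := by
  unfold tailTerm
  have hX : ∀ i j, 0 ≤ (B ^ p * M * Bb ^ q) i j := fun i j =>
    mul_apply_nonneg (fun i j => mul_apply_nonneg (pow_apply_nonneg hB p) hM i j) (pow_apply_nonneg hBb q) i j
  refine mul_nonneg hφ ?_
  simp only [dotProduct]
  exact Finset.sum_nonneg fun l _ => mul_nonneg (hu l) (mulVec_nonneg hX hw l)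

/-- A tail term is non-decreasing in each of its entrywise non-negative ingredients `u, B, M, B̄, w` (census E1
(ii)⇒(iii): "a product of non-negative non-decreasing factors is non-decreasing"). [folklore] -/
theorem tailTerm_mono [Fintype n] [DecidableEq n] {φ : ℝ} {u u' w w' : n → ℝ} {B B' M M' Bb Bb' : Matrix n n ℝ} (hφ : 0 ≤ φ)
    (hu : ∀ i, 0 ≤ u i) (hB : ∀ i j, 0 ≤ B i j) (hM : ∀ i j, 0 ≤ M i j) (hBb : ∀ i j, 0 ≤ Bb i j)
    (hw : ∀ i, 0 ≤ w i)
    (huu : ∀ i, u i ≤ u' i) (hBB : ∀ i j, B i j ≤ B' i j) (hMM : ∀ i j, M i j ≤ M' i j)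
    (hBbb : ∀ i j, Bb i j ≤ Bb' i j) (hww : ∀ i, w i ≤ w' i) (p q : ℕ) :
    tailTerm φ u B p M Bb q w ≤ tailTerm φ u' B' p M' Bb' q w' := by
  unfold tailTerm
  have hBp : ∀ i j, 0 ≤ (B ^ p) i j := pow_apply_nonneg hB p
  have hBbq : ∀ i j, 0 ≤ (Bb ^ q) i j := pow_apply_nonneg hBb q
  have hBM : ∀ i j, 0 ≤ (B ^ p * M) i j := fun i j => mul_apply_nonneg hBp hM i j
  have hX : ∀ i j, 0 ≤ (B ^ p * M * Bb ^ q) i j := fun i j => mul_apply_nonneg hBM hBbq i j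
  have hBM' : ∀ i j, (B ^ p * M) i j ≤ (B' ^ p * M') i j := fun i j =>
    mul_apply_mono hBp hM (pow_apply_mono hB hBB p) hMM i j
  have hXX : ∀ i j, (B ^ p * M * Bb ^ q) i j ≤ (B' ^ p * M' * Bb' ^ q) i j := fun i j =>
    mul_apply_mono hBM hBbq hBM' (pow_apply_mono hBb hBbb q) i j
  refine mul_le_mul_of_nonneg_left ?_ hφ
  exact dotProduct_mono' hu (fun i => mulVec_nonneg hX hw i) huu
    (fun i => mulVec_mono hX hw hXX hww i)

/-! ## Neumann domains and the Collatz–Wielandt divergence certificate -/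

/-- The entrywise Neumann domain: every entry series `Σ_k (B^k)_{ij}` converges (for `B ≥ 0` this is `ρ(B) < 1`,
[DingZhou2009, §1.2 Thm. 1.2]; the validity region `U` of the eigen cells is `NeumannDom (B_s²) ∧ NeumannDom (B̄_s²)`,
`s = i, o`). [cite: DingZhou2009, §1.2 Theorem 1.2 (PDF p. 14)] -/
def NeumannDom [Fintype n] [DecidableEq n] (B : Matrix n n ℝ) : Prop := ∀ i j, Summable fun k => (B ^ k) i j

/-- Along a Collatz–Wielandt vector (`0 ≤ B`, `v ≤ B v` entrywise) one has `v ≤ B^k v` for all `k`. [folklore] -/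
theorem le_pow_mulVec [Fintype n] [DecidableEq n] {B : Matrix n n ℝ} (hB : ∀ i j, 0 ≤ B i j) {v : n → ℝ}
    (hv : ∀ i, v i ≤ (B *ᵥ v) i) : ∀ (k : ℕ) (i : n), v i ≤ (B ^ k *ᵥ v) i := by
  intro k
  induction k with
  | zero => intro i; simp
  | succ k ih =>
    intro i
    rw [pow_succ, ← Matrix.mulVec_mulVec]
    calc v i ≤ (B ^ k *ᵥ v) i := ih i
      _ ≤ (B ^ k *ᵥ (B *ᵥ v)) i := by
        simp only [Matrix.mulVec, dotProduct]
        exact Finset.sum_le_sum fun l _ =>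
          mul_le_mul_of_nonneg_left (hv l) (pow_apply_nonneg hB k i l)

/-- The Neumann domain is DOWNWARD CLOSED on non-negative matrices: `0 ≤ A ≤ B` entrywise and `B ∈ NeumannDom`
imply `A ∈ NeumannDom` (census E1 (iv); [DingZhou2009, Cor. 1.1 + Thm. 1.2]).
[cite: DingZhou2009, §1.2 Corollary 1.1 and Theorem 1.2 (PDF p. 14)] -/
theorem neumannDom_anti [Fintype n] [DecidableEq n] {A B : Matrix n n ℝ} (hA : ∀ i j, 0 ≤ A i j) (hAB : ∀ i j, A i j ≤ B i j)
    (hB : NeumannDom B) : NeumannDom A := fun i j =>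
  Summable.of_nonneg_of_le (fun k => pow_apply_nonneg hA k i j) (fun k => pow_apply_mono hA hAB k i j) (hB i j)

/-- COLLATZ–WIELANDT DIVERGENCE CERTIFICATE.  If `0 ≤ B` entrywise and a vector `v` satisfies `v ≤ B v`
entrywise with `v i₀ > 0`, then `B ∉ NeumannDom` (row `i₀` of `Σ_k B^k` diverges; equivalently `ρ(B) ≥ 1`).  An
interval-verified `B v ≥ v` is therefore an exact certificate that a state lies outside the validity region of
the eigen cells. [cite: DingZhou2009, §1.2 Theorem 1.2 (PDF p. 14) and Exercises 2.9–2.15 (Collatz–Wielandt function, PDF p. 47)] -/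
theorem not_neumannDom_of_subharmonic [Fintype n] [DecidableEq n] {B : Matrix n n ℝ} (hB : ∀ i j, 0 ≤ B i j) {v : n → ℝ}
    (hv : ∀ i, v i ≤ (B *ᵥ v) i) {i₀ : n} (hi : 0 < v i₀) : ¬ NeumannDom B := by
  intro hs
  have hlim : Filter.Tendsto (fun k => (B ^ k *ᵥ v) i₀) Filter.atTop (nhds 0) := by
    have : (fun k => (B ^ k *ᵥ v) i₀) = fun k => ∑ j, (B ^ k) i₀ j * v j := by
      funext k; simp [Matrix.mulVec, dotProduct]
    rw [this]
    have h := tendsto_finsetSum (Finset.univ : Finset n)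
      (fun j _ => ((hs i₀ j).tendsto_atTop_zero).mul_const (v j))
    simpa using h
  obtain ⟨k, hk⟩ := (hlim.eventually (gt_mem_nhds hi)).exists
  exact absurd (le_pow_mulVec hB hv k i₀) (not_le.mpr hk)

/-- Row-sum certificate: if `0 ≤ B` and every row sum is `≥ 1` then `B ∉ NeumannDom` (`v = (1,…,1)` in
`not_neumannDom_of_subharmonic`; REFEREE R32 "certified minimum row sum ≥ 1"). [folklore] -/
theorem not_neumannDom_of_rowSum [Fintype n] [DecidableEq n] [Nonempty n] {B : Matrix n n ℝ}
    (hB : ∀ i j, 0 ≤ B i j) (h : ∀ i, 1 ≤ ∑ j, B i j) : ¬ NeumannDom B := by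
  refine not_neumannDom_of_subharmonic hB (v := fun _ => (1 : ℝ)) ?_ (i₀ := Classical.arbitrary n) one_pos
  intro i
  simpa [Matrix.mulVec, dotProduct] using h i

/-- `NeumannDom` is invariant under transposition (`(Bᵀ)^k = (B^k)ᵀ`). [folklore] -/
theorem neumannDom_transpose_iff [Fintype n] [DecidableEq n] {B : Matrix n n ℝ} :
    NeumannDom Bᵀ ↔ NeumannDom B := by
  unfold NeumannDom
  have key : ∀ (k : ℕ) (i j : n), (Bᵀ ^ k) i j = (B ^ k) j i := fun k i j => by
    rw [← Matrix.transpose_pow, Matrix.transpose_apply]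
  constructor
  · intro h i j
    simpa [key] using h j i
  · intro h i j
    simpa [key] using h j i

/-- Column-sum certificate: if `0 ≤ B` and every column sum is `≥ 1` then `B ∉ NeumannDom`. [folklore] -/
theorem not_neumannDom_of_colSum [Fintype n] [DecidableEq n] [Nonempty n] {B : Matrix n n ℝ}
    (hB : ∀ i j, 0 ≤ B i j) (h : ∀ j, 1 ≤ ∑ i, B i j) : ¬ NeumannDom B := by
  rw [← neumannDom_transpose_iff]
  exact not_neumannDom_of_rowSum (fun i j => hB j i) (fun i => by simpa [Matrix.transpose_apply] using h i)

end Matrices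

/-! ## The frame's validity predicate -/

section FrameLink

open NoGoFrame

variable {ν : Type*}

/-- Discharger of `NoGoFrame.Frame.Hyp.U_down`: if the frame's validity predicate `Frame.U` is (equivalent to) the
convergence of a family of series whose terms are non-negative and non-decreasing in the state on the cone above `y₀`
— the eigen tails of `Percolation.nb` l.841–869 expanded termwise, census E1 (i)–(ii) — then `U` is downward closed
on that cone. [folklore] -/
theorem Frame.U_down_of_termwise (Φ : Frame ν) {ι : Type*} (f : ι → ℕ → State → ℝ) (y₀ : State)
    (hU : ∀ y, y₀ ≤ y → (Φ.U y ↔ ∀ i, Summable fun k => f i k y))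
    (h0 : ∀ i k ⦃y⦄, y₀ ≤ y → 0 ≤ f i k y) (hmono : ∀ i k ⦃x y⦄, y₀ ≤ x → x ≤ y → f i k x ≤ f i k y) :
    ∀ ⦃x y : State⦄, y₀ ≤ x → x ≤ y → Φ.U y → Φ.U x := by
  intro x y hx hxy hy
  exact (hU x hx).2 (down_closed_of_termwise f y₀ h0 hmono hx hxy ((hU y (hx.trans hxy)).1 hy))

/-- The sum of such a series (one eigen tail) is non-decreasing along the cone inside `U` — the tails part of
`NoGoFrame.Frame.Hyp.mono`, census E1 (iii). [folklore] -/
theorem tsum_mono_of_termwise (f : ℕ → State → ℝ) (y₀ : State)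
    (h0 : ∀ k ⦃y⦄, y₀ ≤ y → 0 ≤ f k y) (hmono : ∀ k ⦃x y⦄, y₀ ≤ x → x ≤ y → f k x ≤ f k y)
    ⦃x y : State⦄ (hx : y₀ ≤ x) (hxy : x ≤ y) (hs : Summable fun k => f k y) :
    ∑' k, f k x ≤ ∑' k, f k y :=
  (termwise_summable_mono f y₀ h0 hmono hx hxy hs).2

end FrameLink

end Literature.Probability.FitznerVanDerHofstad2017.EigenTails
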